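import Summits.QuantumFields.YangMills.Theorems.BalabanLadderUVSeamRecCeilingsDLRPeelingExpWeights
import Summits.QuantumFields.YangMills.Theorems.BalabanLadderUVSeamRecCeilingsDLRPeelingLevelSlices
import HarnessLib

/-!
# Crux `UVSeamRec` (stmt-QuantumFields-20043), lane B: slice bookkeeping and the geometric-exponent Hölder assembly for the LINEAR-BUDGET
# (UCR) ⇒ doubled-moments engine (main theorem in the sequel `…CeilingsDLRPeelingLinearBudget`)

Helper file (`--supports stmt-QuantumFields-20043`) of the width-lever seat `ym-20043-ceilings-p2` (lane B, gen 8); prepares the assembly of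
`…CeilingsDLRPeelingExpWeights` (window family ⇒ `⟨exp(Σ t_γ 1_γ)⟩ ≤ exp((1/K)Σ(e^{Kt_γ} − 1)w)`, `K = 256(2m+4)⁴`) and `…CeilingsDLRPeelingLevelSlices`
(level `0` in the same currency from the PROVED plaquette law; Hölder over the 16 sign classes; depth arithmetic).

THE POINT.  g3's level assembly (`…ResponseCarriersLevelwise`) runs Hölder across the levels with exponents `p_k ∝ 1/Λ_k` (`Λ_k` the cap of the
per-polymer coefficient, g3 `sum_sum_fiber_familyCoeff_le_levelCap`), so every level is driven at the top level's strength and the per-level laws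
must be PRODUCT LAWS — whence thinning and the roots `δ^{1/16}` (sign classes) and `w^{1/(16K)}` (g6/g7's (UCR) chain).  Here the exponents are
GEOMETRIC in the depth `j` below the top shell level `K` (`2b^K ≤ R`): `p = 2^{j+1}` at level `K − j` (`Σ_j 2^{−(j+1)} ≤ 1`, the slack on a dummy
slot).  Since `Λ_{K−j} ≤ b^{−4j}` (`levelCap_le_inv_pow`), the exponential weight seen by the level's peeling is `≤ 64K(2/b⁴)^j ≤ 1` once `j ≥ m+4`
(`deep_small`), and there `e^x − 1 ≤ (e−1)x` makes the level's Hölder constant `2(e−1)·1536·w_k·#T` — LINEAR in the (UCR) weight (per-level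
coefficient mass `1536`, tempered-d1 `sum_influenceCoeff_level_le`); such levels fit in the torus (`deep_fits`); the `≤ m+4` top levels are bounded
TRIVIALLY by their coefficient mass (`3072·#T` each; they include g7's non-fitting levels); level `0`, when deep, runs on the proved period-free
plaquette law in the same currency (`torusE_exp_sum_indicator_levelZero_le`).
* `sum_familyCoeff_le_levelCap'` (per-polymer cap), `sum_familyCoeff_slice_le` (per-cube per-level mass), `sum_half_pow_min` (the exponents sum to 1),
  `sum_influence_eq_sum_slices` (the influence functionals of a family, sliced by level).
* `integral_exp_two_mul_sum_le_of_levels` — the abstract assembly: on a probability space, levels `J_k` (`k ≤ kmax`, vanishing above `K`) with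
  `∫exp(2^{j+1}·2J_{K−j}) ≤ exp(2^{j+1}C_j)` for `j ≤ K` give `∫exp(2Σ_k J_k) ≤ exp(Σ_{j≤K} C_j)` (Hölder with exponents `2^{j+1}`, dummy slot).
* `linearised_budget` (`(1/K')Σ(e^{K't}−1)θ ≤ (e−1)θΣt` when `K't ≤ 1`), `deep_weight_le_one`, and the slice moments `slice_exp_moment_trivial`,
  `slice_exp_moment_deep` (window-family law with constant `K''` + small weights ⇒ `∫exp(cΣ_{slice} a_γ1_γ) ≤ exp(c(e−1)·1536·θ·#T)`).
* (sequel: `torusE_exp_two_mul_sum_influence_le_of_uniformConditionalRarity_linear` —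
  `⟨exp(2Σ_{i∈T} influence∘lift)⟩_{2L+1,β} ≤ exp((3072(m+4) + 2(e−1)·1536·(δ₀(β) + Σ_{1≤k≤kmax} w_k))·#T)` versus g7's
  `exp(2e²·1536·(δ₀ + Σ_k w_k^{1/(16K)} + m)·#T)`.)
HONEST FRAMING.  Folklore probability (DLR peeling, Hölder); (UCR_k) is the OPEN one-box large-field input (Bałaban's R-operation currency with
Dirichlet data; classical consistency `ε(β,k) ≳ π⁴/(2(2m+1)⁴)`, `m` free); nothing of E0′; not a gap, not Clay.
References: folklore; T. Bałaban, Commun. Math. Phys. 122 (1989) 355–392 (intended supplier of (UCR_k): `Σ_j exp(−p₀(g_j))`-type budgets).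
-/

set_option autoImplicit false

noncomputable section

open MeasureTheory Filter Topology Finset
open Literature.Probability.LatticeModels
open Literature.MathematicalPhysics.QuantumFieldTheory (GaugeConfig wilsonMeasure LatticeRep isProbabilityMeasure_wilsonMeasure
  measurable_torusLift)
open Literature.MathematicalPhysics.QuantumLattice (LGConfig torusLift IsCylinder ymSpecification isProbabilityMeasure_ymSpecification
  integrable_of_abs_le fundamentalLatticeRep)

namespace Summit.QuantumFields.YangMills.Cruxes.UVSeamRec.DLRPeeling

open Summit.QuantumFields.YangMills.Cruxes.OSLegsFromFemtoAndGap.DlrCollarTransfer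
open Summit.QuantumFields.YangMills.Cruxes.UVSeamRec.PolymerData
open Summit.QuantumFields.YangMills.Cruxes.UVSeamRec.TemperedResponse
open Summit.QuantumFields.YangMills.Theorems.OddTorusChessboard (Orient)

/-! ## §1 Bookkeeping: per-polymer cap, per-cube per-level mass, the exponents, the level slices -/

section Bookkeeping

/-- **Per-polymer cap** (g3's `sum_sum_fiber_familyCoeff_le_levelCap` read on one polymer): for a cube family pairwise cyclically `2R+4`-separated
(`4R+8 ≤ L`), the total coefficient of a level-`k` polymer over all cubes is `Σ_i familyCoeff i γ ≤ 16·(b^k/(R+2+2b^k))⁴`. [folklore] -/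
theorem sum_familyCoeff_le_levelCap' (𝔟 : BlockSize) (kmax R : ℕ) {n L : ℕ} (hRL : 4 * R + 8 ≤ L) (x : Fin n → (Fin 4 → ℤ))
    (hsep : ∀ i j : Fin n, i ≠ j → ∃ k : Fin 4,
      (2 * (R : ℤ) + 4) ≤ |((((x i k - x j k : ℤ) : ZMod (2 * L + 1))).valMinAbs : ℤ)|) (γ : Polymer) :
    ∑ i, familyCoeff 𝔟 kmax R x i γ ≤ 16 * ((𝔟.b : ℝ) ^ γ.k / ((R : ℝ) + 2 + 2 * (𝔟.b : ℝ) ^ γ.k)) ^ 4 := by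
  classical
  have h := sum_sum_fiber_familyCoeff_le_levelCap 𝔟 kmax R hRL x hsep {γ} (γ.k, Torus.proj (2 * L + 1) (anchor 𝔟 γ), γ.μ, γ.ν)
  have hf : ({γ} : Finset Polymer).filter
      (fun γ' => (γ'.k, Torus.proj (2 * L + 1) (anchor 𝔟 γ'), γ'.μ, γ'.ν) = (γ.k, Torus.proj (2 * L + 1) (anchor 𝔟 γ), γ.μ, γ.ν)) =
      {γ} := by
    rw [Finset.filter_singleton, if_pos rfl]
  simpa only [hf, Finset.sum_singleton] using h

/-- **Per-cube per-level mass** (tempered-d1's `sum_influenceCoeff_level_le` read through the family coefficients): for any family `S` of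
level-`k` polymers, `Σ_{γ∈S} familyCoeff i γ ≤ 1536`. [folklore] -/
theorem sum_familyCoeff_slice_le (𝔟 : BlockSize) (kmax R : ℕ) {n : ℕ} (x : Fin n → (Fin 4 → ℤ)) (i : Fin n) (k : ℕ)
    (S : Finset Polymer) (hSk : ∀ γ ∈ S, γ.k = k) : ∑ γ ∈ S, familyCoeff 𝔟 kmax R x i γ ≤ 1536 := by
  classical
  have h1 : ∑ γ ∈ S, familyCoeff 𝔟 kmax R x i γ = ∑ γ ∈ S.filter (fun γ => γ ∈ shell 𝔟 kmax R (x i)), influenceCoeff 𝔟 γ (x i) := by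
    rw [Finset.sum_filter]
    rfl
  rw [h1]
  have hsub : S.filter (fun γ => γ ∈ shell 𝔟 kmax R (x i)) ⊆ (shell 𝔟 kmax R (x i)).filter (fun γ => γ.k = k) := by
    intro γ hγ
    obtain ⟨hγS, hγsh⟩ := Finset.mem_filter.1 hγ
    exact Finset.mem_filter.2 ⟨hγsh, hSk γ hγS⟩
  exact (Finset.sum_le_sum_of_subset_of_nonneg hsub fun γ _ _ => influenceCoeff_nonneg 𝔟 γ (x i)).trans
    (sum_influenceCoeff_level_le 𝔟 kmax R (x i) k)

/-- The geometric Hölder exponents sum to one: `Σ_{j ≤ K+1} 2^{−(min(j,K)+1)} = Σ_{j ≤ K} 2^{−(j+1)} + 2^{−(K+1)} = 1`. [folklore] -/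
theorem sum_half_pow_min (K : ℕ) : ∑ j ∈ Finset.range (K + 2), ((1 : ℝ) / 2) ^ (min j K + 1) = 1 := by
  have key : ∀ K : ℕ, ∑ j ∈ Finset.range (K + 1), ((1 : ℝ) / 2) ^ (j + 1) + ((1 : ℝ) / 2) ^ (K + 1) = 1 := by
    intro K
    induction K with
    | zero => norm_num
    | succ K ih =>
      rw [Finset.sum_range_succ, add_assoc, show ((1 : ℝ) / 2) ^ (K + 1 + 1) + ((1 : ℝ) / 2) ^ (K + 1 + 1) = (1 / 2) ^ (K + 1) by ring]
      exact ih
  rw [Finset.sum_range_succ, min_eq_right (Nat.le_succ K)]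
  have h1 : ∑ j ∈ Finset.range (K + 1), ((1 : ℝ) / 2) ^ (min j K + 1) = ∑ j ∈ Finset.range (K + 1), ((1 : ℝ) / 2) ^ (j + 1) :=
    Finset.sum_congr rfl fun j hj => by rw [min_eq_left (Nat.lt_succ_iff.1 (Finset.mem_range.1 hj))]
  rw [h1]
  exact key K

variable {N : ℕ} [NeZero N]

/-- **The influence functionals of a family, sliced by level.**  `Σ_{i∈T} influence(x i)(η) = Σ_{k ≤ kmax} Σ_{γ ∈ familyShell, γ.k = k}
(Σ_{i∈T} familyCoeff i γ)·1_{E_γ}(η)` (tempered-d1's `influence_eq_familySum`, then exchange and slice). [folklore] -/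
theorem sum_influence_eq_sum_slices (𝔟 : BlockSize) (ε : ℕ → ℝ) (kmax R : ℕ) {n : ℕ} (x : Fin n → (Fin 4 → ℤ)) (T : Finset (Fin n))
    (η : LGConfig 4 (Matrix.specialUnitaryGroup (Fin N) ℂ)) :
    ∑ i ∈ T, influence (N := N) 𝔟 ε kmax R (x i) η =
      ∑ k ∈ Finset.range (kmax + 1), ∑ γ ∈ (familyShell 𝔟 kmax R x).filter (fun γ => γ.k = k),
        (∑ i ∈ T, familyCoeff 𝔟 kmax R x i γ) * (largeFieldEvent (N := N) 𝔟 (ε γ.k) γ).indicator (fun _ => (1 : ℝ)) η := by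
  classical
  have h1 : ∑ i ∈ T, influence (N := N) 𝔟 ε kmax R (x i) η =
      ∑ γ ∈ familyShell 𝔟 kmax R x, (∑ i ∈ T, familyCoeff 𝔟 kmax R x i γ) *
        (largeFieldEvent (N := N) 𝔟 (ε γ.k) γ).indicator (fun _ => (1 : ℝ)) η := by
    simp_rw [influence_eq_familySum (N := N) 𝔟 ε kmax R x, Finset.sum_mul]
    rw [Finset.sum_comm]
  rw [h1]
  symm
  refine Finset.sum_fiberwise_of_maps_to (fun γ hγ => ?_) _
  obtain ⟨i, _, hi⟩ := Finset.mem_biUnion.1 hγ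
  exact Finset.mem_range.2 (Nat.lt_succ_of_le (level_le_of_mem_shell hi))

end Bookkeeping

/-! ## §2 The geometric-exponent Hölder assembly (abstract) -/

section Assembly

/-- **Hölder across the levels with exponents `2^{j+1}`.**  On a probability space: levels `J_k` (`k ≤ kmax`), measurable and uniformly bounded,
vanishing at the levels `K < k ≤ kmax`; if `∫exp(2^{j+1}·(2J_{K−j})) ≤ exp(2^{j+1}·C_j)` for every `j ≤ K`, then `∫exp(2Σ_{k≤kmax} J_k) ≤ exp(Σ_{j≤K} C_j)`
— the generalised Hölder inequality over `j ∈ {0,…,K+1}` with exponents `2^{min(j,K)+1}` (`Σ 2^{−(min(j,K)+1)} = 1`, the slot `K+1` a dummy). [folklore] -/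
theorem integral_exp_two_mul_sum_le_of_levels {Ω : Type*} [MeasurableSpace Ω] (μ : Measure Ω) [IsProbabilityMeasure μ]
    (J : ℕ → Ω → ℝ) (hJm : ∀ k, Measurable (J k)) {M : ℝ} (hJb : ∀ k ω, |J k ω| ≤ M) (kmax K : ℕ) (hK : K ≤ kmax)
    (hzero : ∀ k, K < k → k ≤ kmax → ∀ ω, J k ω = 0) (C : ℕ → ℝ)
    (hmom : ∀ j, j ≤ K → ∫ ω, Real.exp ((2 : ℝ) ^ (j + 1) * (2 * J (K - j) ω)) ∂μ ≤ Real.exp ((2 : ℝ) ^ (j + 1) * C j)) :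
    ∫ ω, Real.exp (2 * ∑ k ∈ Finset.range (kmax + 1), J k ω) ∂μ ≤ Real.exp (∑ j ∈ Finset.range (K + 1), C j) := by
  classical
  -- reduce to the levels `≤ K` and reflect
  have hsumK : ∀ ω, ∑ k ∈ Finset.range (kmax + 1), J k ω = ∑ j ∈ Finset.range (K + 1), J (K - j) ω := by
    intro ω
    have h1 : ∑ k ∈ Finset.range (K + 1), J k ω = ∑ k ∈ Finset.range (kmax + 1), J k ω :=
      Finset.sum_subset (fun k hk => Finset.mem_range.2 (lt_of_lt_of_le (Finset.mem_range.1 hk) (Nat.succ_le_succ hK)))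
        fun k hk hk' => by
        have h2 : k < kmax + 1 := Finset.mem_range.1 hk
        have h3 : ¬ k < K + 1 := fun h => hk' (Finset.mem_range.2 h)
        exact hzero k (by omega) (by omega) ω
    rw [← h1, ← Finset.sum_range_reflect (fun k => J k ω) (K + 1)]
    simp only [add_tsub_cancel_right]
  -- the Hölder family on `range (K+2)` with a dummy slot
  let F : ℕ → Ω → ℝ := fun j ω => if j ≤ K then 2 * J (K - j) ω else 0
  let p : ℕ → ℝ := fun j => (2 : ℝ) ^ (min j K + 1)
  let C' : ℕ → ℝ := fun j => if j ≤ K then C j else 0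
  have hp0 : ∀ j, 0 < p j := fun j => by positivity
  have hpsum : ∑ j ∈ Finset.range (K + 2), 1 / p j = 1 := by
    have : ∀ j, 1 / p j = ((1 : ℝ) / 2) ^ (min j K + 1) := fun j => by simp only [p, one_div, inv_pow]
    simp only [this]
    exact sum_half_pow_min K
  have hFm : ∀ j ∈ Finset.range (K + 2), Measurable (F j) := by
    intro j _
    by_cases hjK : j ≤ K
    · have : F j = fun ω => 2 * J (K - j) ω := funext fun ω => if_pos hjK
      rw [this]; exact (hJm _).const_mul 2
    · have : F j = fun _ => (0 : ℝ) := funext fun ω => if_neg hjK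
      rw [this]; exact measurable_const
  have hFb : ∀ j ∈ Finset.range (K + 2), ∀ ω, |F j ω| ≤ 2 * |M| := by
    intro j _ ω
    by_cases hjK : j ≤ K
    · simp only [F, if_pos hjK, abs_mul, abs_two]
      exact mul_le_mul_of_nonneg_left ((hJb _ ω).trans (le_abs_self M)) zero_le_two
    · simp only [F, if_neg hjK, abs_zero]; positivity
  have hmom' : ∀ j ∈ Finset.range (K + 2), ∫ ω, Real.exp (p j * F j ω) ∂μ ≤ Real.exp (p j * C' j) := by
    intro j _
    by_cases hjK : j ≤ K
    · have hpj : p j = (2 : ℝ) ^ (j + 1) := by simp only [p, min_eq_left hjK]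
      have hF : ∀ ω, F j ω = 2 * J (K - j) ω := fun ω => if_pos hjK
      have hC : C' j = C j := if_pos hjK
      simp only [hF, hpj, hC]
      exact hmom j hjK
    · have hF : ∀ ω, F j ω = 0 := fun ω => if_neg hjK
      have hC : C' j = 0 := if_neg hjK
      simp only [hF, hC, mul_zero, Real.exp_zero, integral_const, smul_eq_mul, mul_one, probReal_univ, le_refl]
  have key := PolymerRarity.integral_exp_sum_le_exp_sum_of_holder μ (Finset.range (K + 2)) F hFm (fun _ => 2 * |M|) hFb p C'
    (fun j _ => hp0 j) hpsum hmom'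
  have hlhs : ∀ ω, ∑ j ∈ Finset.range (K + 2), F j ω = 2 * ∑ k ∈ Finset.range (kmax + 1), J k ω := by
    intro ω
    rw [hsumK, Finset.mul_sum, Finset.sum_range_succ]
    have h0 : F (K + 1) ω = 0 := if_neg (by omega)
    rw [h0, add_zero]
    exact Finset.sum_congr rfl fun j hj => if_pos (Nat.lt_succ_iff.1 (Finset.mem_range.1 hj))
  have hrhs : ∑ j ∈ Finset.range (K + 2), C' j = ∑ j ∈ Finset.range (K + 1), C j := by
    rw [Finset.sum_range_succ]
    have h0 : C' (K + 1) = 0 := if_neg (by omega)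
    rw [h0, add_zero]
    exact Finset.sum_congr rfl fun j hj => if_pos (Nat.lt_succ_iff.1 (Finset.mem_range.1 hj))
  simp only [hlhs] at key
  rw [hrhs] at key
  exact key

end Assembly

/-! ## §3 The slices: linearisation, the deep weight, the slice moments -/

section Slices

/-- **Linearisation**: if `0 ≤ t_γ`, `K'·t_γ ≤ 1` on `S`, `θ ≥ 0`, then `(1/K')·Σ_{γ∈S}(e^{K't_γ} − 1)·θ ≤ (e − 1)·θ·Σ_{γ∈S} t_γ`
(`e^x − 1 ≤ (e−1)x` on `[0,1]`, convexity). [folklore] -/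
theorem linearised_budget {ι : Type*} (S : Finset ι) (t : ι → ℝ) {K' θ : ℝ} (hK' : 0 < K') (hθ : 0 ≤ θ)
    (ht : ∀ γ ∈ S, 0 ≤ t γ) (hsmall : ∀ γ ∈ S, K' * t γ ≤ 1) :
    1 / K' * ∑ γ ∈ S, (Real.exp (K' * t γ) - 1) * θ ≤ (Real.exp 1 - 1) * θ * ∑ γ ∈ S, t γ := by
  rw [Finset.mul_sum, Finset.mul_sum]
  refine Finset.sum_le_sum fun γ hγ => ?_
  have hu0 : 0 ≤ K' * t γ := mul_nonneg hK'.le (ht γ hγ)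
  have hconv : Real.exp (K' * t γ) - 1 ≤ (Real.exp 1 - 1) * (K' * t γ) := by
    have h := convexOn_exp.2 (Set.mem_univ (0 : ℝ)) (Set.mem_univ (1 : ℝ)) (show (0 : ℝ) ≤ 1 - K' * t γ by linarith [hsmall γ hγ])
      hu0 (show (1 - K' * t γ) + K' * t γ = 1 by ring)
    simp only [smul_eq_mul, mul_zero, zero_add, mul_one, Real.exp_zero] at h
    linarith
  have h1 : 1 / K' * ((Real.exp (K' * t γ) - 1) * θ) ≤ 1 / K' * ((Real.exp 1 - 1) * (K' * t γ) * θ) :=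
    mul_le_mul_of_nonneg_left (mul_le_mul_of_nonneg_right hconv hθ) (by positivity)
  refine h1.trans (le_of_eq ?_)
  rw [show 1 / K' * ((Real.exp 1 - 1) * (K' * t γ) * θ) = K' / K' * ((Real.exp 1 - 1) * θ * t γ) by ring, div_self hK'.ne', one_mul]

/-- **The deep weight is at most `1`**: at depth `j ≥ m+4` below the top shell level (`2b^K ≤ R`, `k + j = K`), a coefficient `a` under the level cap
satisfies `16·(256(2m+4)⁴)·(2^{j+1}·2·a) ≤ 1` (`levelCap_le_inv_pow` + `deep_small`). [folklore] -/
theorem deep_weight_le_one (𝔟 : BlockSize) {m R K k j : ℕ} (hm : 3 ≤ m) (hK : 2 * 𝔟.b ^ K ≤ R) (hkj : k + j = K) (hj : m + 4 ≤ j)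
    {a : ℝ} (ha : a ≤ 16 * ((𝔟.b : ℝ) ^ k / ((R : ℝ) + 2 + 2 * (𝔟.b : ℝ) ^ k)) ^ 4) :
    16 * (256 * (2 * (m : ℝ) + 4) ^ 4) * ((2 : ℝ) ^ (j + 1) * 2 * a) ≤ 1 := by
  have hcap := ha.trans (levelCap_le_inv_pow 𝔟 hK hkj)
  have hb0 : (0 : ℝ) < (𝔟.b : ℝ) := by exact_mod_cast 𝔟.pos
  calc 16 * (256 * (2 * (m : ℝ) + 4) ^ 4) * ((2 : ℝ) ^ (j + 1) * 2 * a)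
      ≤ 16 * (256 * (2 * (m : ℝ) + 4) ^ 4) * ((2 : ℝ) ^ (j + 1) * 2 * (1 / ((𝔟.b : ℝ) ^ 4) ^ j)) :=
        mul_le_mul_of_nonneg_left (mul_le_mul_of_nonneg_left hcap (by positivity)) (by positivity)
    _ = 64 * (256 * (2 * (m : ℝ) + 4) ^ 4) * (2 / (𝔟.b : ℝ) ^ 4) ^ j := by rw [div_pow, pow_succ]; ring
    _ ≤ 1 := deep_small 𝔟 hm hj

variable {N : ℕ} [NeZero N]

/-- **The trivial slice moment**: a slice functional `J = Σ_{γ ∈ slice} a_γ 1_γ` with `a_γ = Σ_{i∈T} familyCoeff i γ` is at most `1536·#T`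
(per-cube per-level mass), so `∫exp(c·J∘lift) ≤ exp(c·1536·#T)` for `c ≥ 0`. [folklore] -/
theorem slice_exp_moment_trivial (β : ℝ) (𝔟 : BlockSize) (ε : ℕ → ℝ) (kmax R L k : ℕ) {n : ℕ} (x : Fin n → (Fin 4 → ℤ))
    (T : Finset (Fin n)) {c : ℝ} (hc : 0 ≤ c) :
    ∫ U, Real.exp (c * ∑ γ ∈ (familyShell 𝔟 kmax R x).filter (fun γ => γ.k = k),
        (∑ i ∈ T, familyCoeff 𝔟 kmax R x i γ) * (largeFieldEvent (N := N) 𝔟 (ε γ.k) γ).indicator (fun _ => (1 : ℝ)) (torusLift (2 * L + 1) U))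
      ∂(wilsonMeasure (d := 4) (L := 2 * L + 1) (fundamentalLatticeRep N).ρ β) ≤ Real.exp (c * (1536 * T.card)) := by
  classical
  haveI := isProbabilityMeasure_wilsonMeasure (d := 4) (L := 2 * L + 1) (fundamentalLatticeRep N).ρ
    (fundamentalLatticeRep N).continuous β
  set S := (familyShell 𝔟 kmax R x).filter (fun γ => γ.k = k) with hSdef
  have hSk : ∀ γ ∈ S, γ.k = k := fun γ hγ => (Finset.mem_filter.1 hγ).2
  have ha0 : ∀ γ, 0 ≤ ∑ i ∈ T, familyCoeff 𝔟 kmax R x i γ := fun γ => Finset.sum_nonneg fun i _ => familyCoeff_nonneg 𝔟 kmax R x i γ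
  have hχ01 : ∀ γ (U : LGConfig 4 (Matrix.specialUnitaryGroup (Fin N) ℂ)),
      0 ≤ (largeFieldEvent (N := N) 𝔟 (ε γ.k) γ).indicator (fun _ => (1 : ℝ)) U ∧
        (largeFieldEvent (N := N) 𝔟 (ε γ.k) γ).indicator (fun _ => (1 : ℝ)) U ≤ 1 := fun γ U =>
    ⟨Set.indicator_nonneg (fun _ _ => zero_le_one) _, Set.indicator_apply_le' (fun _ => le_rfl) (fun _ => zero_le_one)⟩
  have hmass : ∑ γ ∈ S, ∑ i ∈ T, familyCoeff 𝔟 kmax R x i γ ≤ 1536 * T.card := by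
    calc ∑ γ ∈ S, ∑ i ∈ T, familyCoeff 𝔟 kmax R x i γ = ∑ i ∈ T, ∑ γ ∈ S, familyCoeff 𝔟 kmax R x i γ := Finset.sum_comm
      _ ≤ ∑ _i ∈ T, (1536 : ℝ) := Finset.sum_le_sum fun i _ => sum_familyCoeff_slice_le 𝔟 kmax R x i k S hSk
      _ = 1536 * T.card := by rw [Finset.sum_const, nsmul_eq_mul, mul_comm]
  have hJle : ∀ U : LGConfig 4 (Matrix.specialUnitaryGroup (Fin N) ℂ),
      ∑ γ ∈ S, (∑ i ∈ T, familyCoeff 𝔟 kmax R x i γ) * (largeFieldEvent (N := N) 𝔟 (ε γ.k) γ).indicator (fun _ => (1 : ℝ)) U ≤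
        1536 * T.card := fun U =>
    (Finset.sum_le_sum fun γ _ => by simpa using mul_le_mul_of_nonneg_left (hχ01 γ U).2 (ha0 γ)).trans hmass
  have hmeas : Measurable fun U : GaugeConfig 4 (2 * L + 1) (Matrix.specialUnitaryGroup (Fin N) ℂ) => Real.exp (c * ∑ γ ∈ S,
      (∑ i ∈ T, familyCoeff 𝔟 kmax R x i γ) * (largeFieldEvent (N := N) 𝔟 (ε γ.k) γ).indicator (fun _ => (1 : ℝ)) (torusLift (2 * L + 1) U)) :=
    ((Finset.measurable_sum _ fun γ _ => ((measurable_const.indicator (measurableSet_largeFieldEvent (N := N) 𝔟 _ γ)).comp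
      (measurable_torusLift _)).const_mul _).const_mul _).exp
  have hpt : ∀ U : GaugeConfig 4 (2 * L + 1) (Matrix.specialUnitaryGroup (Fin N) ℂ), Real.exp (c * ∑ γ ∈ S,
      (∑ i ∈ T, familyCoeff 𝔟 kmax R x i γ) * (largeFieldEvent (N := N) 𝔟 (ε γ.k) γ).indicator (fun _ => (1 : ℝ)) (torusLift (2 * L + 1) U)) ≤
      Real.exp (c * (1536 * T.card)) := fun U => Real.exp_le_exp.2 (mul_le_mul_of_nonneg_left (hJle _) hc)
  calc _ ≤ ∫ _U, Real.exp (c * (1536 * T.card)) ∂(wilsonMeasure (d := 4) (L := 2 * L + 1) (fundamentalLatticeRep N).ρ β) :=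
        integral_mono (integrable_of_abs_le hmeas (C := Real.exp (c * (1536 * T.card))) fun U => by rw [Real.abs_exp]; exact hpt U)
          (integrable_const _) hpt
    _ = Real.exp (c * (1536 * T.card)) := by rw [integral_const, smul_eq_mul, probReal_univ, one_mul]

/-- **The deep slice moment.**  Fundamental `SU(N)`, odd torus `2L+1`, any `β`; a REDUCED cube family with `4R+8 ≤ L`; block size `𝔟`, cutoff `kmax`,
threshold `ε`, level `k`; a window-family law at level `k` in the exponential currency with constant `K'' > 0` and weight `θ ≥ 0` (as in
`torusE_exp_sum_le_of_signClasses`); a rate `c ≥ 0` such that the weights are small on the slice: `16K''·c·a_γ ≤ 1` for every level-`k` member `γ`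
of the family shell, `a_γ = Σ_{i∈T} familyCoeff i γ`.  THEN `∫exp(c·Σ_{γ ∈ slice} a_γ·1_{largeFieldEvent 𝔟 ε γ}∘lift) ≤ exp(c·((e−1)·1536·θ·#T))` —
LINEAR in `θ`: sign classes (`K'' ↦ 16K''` inside the weight), linearisation, per-cube per-level mass. [folklore] -/
theorem slice_exp_moment_deep (β : ℝ) (𝔟 : BlockSize) (ε : ℝ) (kmax R L k : ℕ) (hRL : 4 * R + 8 ≤ L)
    {n : ℕ} (x : Fin n → (Fin 4 → ℤ)) (hred : ∀ i c, |x i c| ≤ (L : ℤ)) (T : Finset (Fin n)) {K'' θ : ℝ} (hK'' : 0 < K'') (hθ : 0 ≤ θ)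
    (hWF : ∀ (o : Fin 4 → ℤ) (A : Finset Polymer), A ⊆ familyShell 𝔟 kmax R x → (∀ γ ∈ A, γ.k = k) →
      (∀ γ ∈ A, ∀ c, o c ≤ anchor 𝔟 γ c ∧ anchor 𝔟 γ c + (𝔟.b : ℤ) ^ k ≤ o c + (2 * L + 1)) →
      ∀ t : Polymer → ℝ, (∀ γ ∈ A, 0 ≤ t γ) →
      torusE (Matrix.specialUnitaryGroup (Fin N) ℂ) (fundamentalLatticeRep N) β L (fun U => Real.exp (∑ γ ∈ A,
        t γ * (largeFieldEvent (N := N) 𝔟 ε γ).indicator (fun _ => (1 : ℝ)) U)) ≤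
        Real.exp (1 / K'' * ∑ γ ∈ A, (Real.exp (K'' * t γ) - 1) * θ))
    {c : ℝ} (hc : 0 ≤ c)
    (hsmall : ∀ γ ∈ (familyShell 𝔟 kmax R x).filter (fun γ => γ.k = k), 16 * K'' * (c * ∑ i ∈ T, familyCoeff 𝔟 kmax R x i γ) ≤ 1) :
    ∫ U, Real.exp (c * ∑ γ ∈ (familyShell 𝔟 kmax R x).filter (fun γ => γ.k = k),
        (∑ i ∈ T, familyCoeff 𝔟 kmax R x i γ) * (largeFieldEvent (N := N) 𝔟 ε γ).indicator (fun _ => (1 : ℝ)) (torusLift (2 * L + 1) U))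
      ∂(wilsonMeasure (d := 4) (L := 2 * L + 1) (fundamentalLatticeRep N).ρ β) ≤
      Real.exp (c * ((Real.exp 1 - 1) * 1536 * θ * T.card)) := by
  classical
  set S := (familyShell 𝔟 kmax R x).filter (fun γ => γ.k = k) with hSdef
  have hSk : ∀ γ ∈ S, γ.k = k := fun γ hγ => (Finset.mem_filter.1 hγ).2
  have hSsub : S ⊆ familyShell 𝔟 kmax R x := Finset.filter_subset _ _
  set a : Polymer → ℝ := fun γ => ∑ i ∈ T, familyCoeff 𝔟 kmax R x i γ with hadef
  have ha0 : ∀ γ, 0 ≤ a γ := fun γ => Finset.sum_nonneg fun i _ => familyCoeff_nonneg 𝔟 kmax R x i γ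
  have hmass : ∑ γ ∈ S, a γ ≤ 1536 * T.card := by
    calc ∑ γ ∈ S, a γ = ∑ i ∈ T, ∑ γ ∈ S, familyCoeff 𝔟 kmax R x i γ := Finset.sum_comm
      _ ≤ ∑ _i ∈ T, (1536 : ℝ) := Finset.sum_le_sum fun i _ => sum_familyCoeff_slice_le 𝔟 kmax R x i k S hSk
      _ = 1536 * T.card := by rw [Finset.sum_const, nsmul_eq_mul, mul_comm]
  -- the slice law with coefficients `c·a`
  have h := torusE_exp_sum_le_of_signClasses (N := N) β 𝔟 ε kmax R L k hRL x hred hK'' hWF S hSsub hSk (fun γ => c * a γ)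
    (fun γ _ => mul_nonneg hc (ha0 γ))
  have hlin := linearised_budget S (fun γ => c * a γ) (K' := 16 * K'') (by positivity) hθ (fun γ _ => mul_nonneg hc (ha0 γ))
    (fun γ hγ => by simpa only [hadef, mul_assoc] using hsmall γ hγ)
  have hlhs : (torusE (Matrix.specialUnitaryGroup (Fin N) ℂ) (fundamentalLatticeRep N) β L fun U =>
      Real.exp (∑ γ ∈ S, c * a γ * (largeFieldEvent (N := N) 𝔟 ε γ).indicator (fun _ => (1 : ℝ)) U)) =
      ∫ U, Real.exp (c * ∑ γ ∈ S, a γ * (largeFieldEvent (N := N) 𝔟 ε γ).indicator (fun _ => (1 : ℝ)) (torusLift (2 * L + 1) U))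
        ∂(wilsonMeasure (d := 4) (L := 2 * L + 1) (fundamentalLatticeRep N).ρ β) := by
    unfold torusE
    refine integral_congr_ae (ae_of_all _ fun U => congrArg Real.exp ?_)
    rw [Finset.mul_sum]
    exact Finset.sum_congr rfl fun γ _ => by ring
  rw [hlhs] at h
  refine h.trans (Real.exp_le_exp.2 ?_)
  calc 1 / (16 * K'') * ∑ γ ∈ S, (Real.exp (16 * K'' * (c * a γ)) - 1) * θ
      ≤ (Real.exp 1 - 1) * θ * ∑ γ ∈ S, c * a γ := hlin
    _ = c * ((Real.exp 1 - 1) * θ * ∑ γ ∈ S, a γ) := by rw [← Finset.mul_sum]; ring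
    _ ≤ c * ((Real.exp 1 - 1) * θ * (1536 * T.card)) := by
        refine mul_le_mul_of_nonneg_left (mul_le_mul_of_nonneg_left hmass ?_) hc
        have : 0 ≤ Real.exp 1 - 1 := by linarith [Real.add_one_le_exp (1 : ℝ)]
        positivity
    _ = c * ((Real.exp 1 - 1) * 1536 * θ * T.card) := by ring

end Slices

end Summit.QuantumFields.YangMills.Cruxes.UVSeamRec.DLRPeeling

end
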